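import Literature.Computability.FineGrained.BKGadgetPiece
import Literature.Computability.FineGrained.BKGadgetPrefix
import Literature.Computability.FineGrained.BKGadgetUpper
import HarnessLib

/-!
# The Bringmann–Künnemann alignment gadget: the lower bound and Lemma 5.4

K. Bringmann, M. Künnemann, *Quadratic conditional lower bounds for string problems and dynamic
time warping*, FOCS 2015 (arXiv:1502.01063), §5.2, proof of Lemma 5.4 for `c_subst = 1`
(`β = 4/5`), second half ("It remains to prove the lower bound …"), and the discharge
`alignmentGadget_editDist_holds` of the named fact `alignmentGadget_editDist` (`BKGadget`; part (i)
is `editDist_gadget_le_structuredCost` of `BKGadgetUpper`).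

The lower bound (`exists_alignment_le`) follows the printed proof literally: split an optimal
traversal of `(x, y)` along the `2m+1` blocks `Lʸ, G(y₁), 0^{γ₂}, …, G(y_m), Rʸ` of `y` (Fact 5.7,
`Cryptography.exists_boundaries_editDist_le`; the block list and its entries:
`Params.flatten_blocksY`, `Params.blocksY_getD_*`); align `j` with the first `i` whose `xᵢ` lies
in the piece facing `G(yⱼ)` ("align `j` with any such `i`"; this is an alignment,
`isAlignment_filterMap_find`, and its cost is read off block by block,
`sum_map_filterMap_add_mul`); bound the pieces from below — prefix and suffix by Lemma 5.8
(`Params.five_mul_le_editDist_take_gadgetX`, `…drop…`), pieces facing separators by their length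
deficit (Fact 5.5(2)), pieces facing `G(yⱼ)` by Claim 5.9 (`Params.piece_bound`) — and add up
(`sum_range_two_mul` pairs block `2j+1` with block `2j+2`), using `∑ |pieces| = |x| = nγ₄ + (n-1)γ₂`
and `5C = 10nγ₃ - 4(n-m)(γ₄+γ₂)`.

Supporting files: `Cryptography.EditDistBlocks` (Facts 5.5–5.7 in the forms needed),
`BKGadgetStructure` (block structure of `x`, `y`), `BKGadgetPrefix` (Lemma 5.8), `BKGadgetWindow`
and `BKGadgetClaim` (Claim 5.9 in the frame `0^{γ₂} G(xᵢ) 0^{γ₂}`), `BKGadgetPiece` (Claim 5.9 for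
the pieces of `x`), `BKGadgetUpper` (part (i)).
-/

namespace Literature.Computability.FineGrained

open Cryptography Finset

namespace BKGadget

/-! ### Sums -/

/-- Pairing consecutive terms: `∑_{k<2M} g k = ∑_{j<M} (g(2j) + g(2j+1))`. [folklore] -/
theorem sum_range_two_mul (g : ℕ → ℕ) (M : ℕ) :
    ∑ k ∈ range (2 * M), g k = ∑ j ∈ range M, (g (2 * j) + g (2 * j + 1)) := by
  induction M with
  | zero => simp
  | succ M ih =>
      rw [show 2 * (M + 1) = 2 * M + 1 + 1 by ring, sum_range_succ, sum_range_succ, ih,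
        sum_range_succ]
      ring

/-- Reading off a cost block by block: if `s a` selects a partner for `a` (or none), then summing
`v` over the selected pairs and a punishment `M` over the unselected `a` is the sum over all `a` of
"`v` if selected, `M` otherwise". [folklore] -/
theorem sum_map_filterMap_add_mul {α β : Type*} (L : List α) (s : α → Option β) (v : β → α → ℕ)
    (M : ℕ) :
    ((L.filterMap fun a => (s a).map fun b => (b, a)).map fun p => v p.1 p.2).sum +
        (L.length - (L.filterMap fun a => (s a).map fun b => (b, a)).length) * M =
      (L.map fun a => (s a).elim M fun b => v b a).sum := by
  induction L with
  | nil => simp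
  | cons a L ih =>
      have hle := List.length_filterMap_le (fun a => (s a).map fun b => (b, a)) L
      cases hs : s a with
      | none =>
          simp only [List.filterMap_cons, hs, Option.map_none, List.map_cons, List.sum_cons,
            Option.elim_none, List.length_cons]
          rw [← ih, Nat.succ_sub hle, Nat.succ_mul]
          ring
      | some b =>
          simp only [List.filterMap_cons, hs, Option.map_some, List.map_cons, List.sum_cons,
            Option.elim_some, List.length_cons, Nat.add_sub_add_right]
          rw [← ih]
          ring

/-! ### The alignment "first input block inside the piece" is an alignment -/

/-- **The alignment of the proof of Lemma 5.4 is an alignment** (BK15: "no `xᵢ` or `yⱼ` can be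
aligned more than once"): if `j` is aligned with the first `i` whose positions
`[pos i, pos i + ℓ]` lie inside the `j`-th piece `[a j, b j)`, where `pos i < pos i'` only for
`i < i'` and the pieces are ordered (`b j ≤ a j'` for `j < j'`), then the aligned pairs have
increasing `i`'s and `j`'s. [cite: BringmannKunnemannFOCS2015, Lemma 5.4 (proof)] -/
theorem isAlignment_filterMap_find {n m : ℕ} (pos : ℕ → ℕ) (hpos : ∀ i i', pos i < pos i' → i < i')
    (ℓ : ℕ) (a b : ℕ → ℕ) (hab : ∀ j j', j < j' → b j ≤ a j') :
    IsAlignment ((List.finRange m).filterMap fun j : Fin m =>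
      ((List.finRange n).find? fun i : Fin n =>
        decide (a j ≤ pos i ∧ pos i + ℓ + 1 ≤ b j)).map fun i => (i, j)) := by
  unfold IsAlignment
  rw [List.pairwise_filterMap]
  refine (List.pairwise_lt_finRange m).imp fun {j j'} hjj' => ?_
  intro p hp p' hp'
  obtain ⟨i, hi, rfl⟩ := Option.map_eq_some_iff.1 hp
  obtain ⟨i', hi', rfl⟩ := Option.map_eq_some_iff.1 hp'
  have h1 := List.find?_some hi
  have h2 := List.find?_some hi'
  simp only [decide_eq_true_eq] at h1 h2
  have h3 := hab j j' hjj'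
  refine ⟨?_, hjj'⟩
  have : pos i < pos i' := by omega
  exact Fin.lt_def.2 (hpos i i' this)

namespace Params

variable (P : Params)

/-! ### The blocks of `y` -/

/-- `y = Lʸ G(y₁) 0^{γ₂} ⋯ G(y_m) Rʸ` is the concatenation of the `2m+1` blocks
`[Lʸ, G(y₁), 0^{γ₂}, G(y₂), …, G(y_m), Rʸ]`. [cite: BringmannKunnemannFOCS2015, Lemma 5.3] -/
theorem flatten_blocksY (N : ℕ) (ys : List (List Bool)) :
    (zeros N :: (List.intersperse (zeros P.γ₂) (ys.map P.guard) ++ [zeros N])).flatten =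
      zeros N ++ P.gadgetX ys ++ zeros N := by
  simp [gadgetX, List.intercalate.eq_def, List.append_assoc]

/-- There are `2m+1` blocks (`m ≥ 1`). [folklore] -/
theorem length_blocksY (N : ℕ) (ys : List (List Bool)) (hys : 1 ≤ ys.length) :
    (zeros N :: (List.intersperse (zeros P.γ₂) (ys.map P.guard) ++ [zeros N])).length =
      2 * ys.length + 1 := by
  simp [List.length_intersperse]; omega

/-- Block `2j+1` is `G(yⱼ)` (`j < m`, 0-based). [folklore] -/
theorem blocksY_getD_odd (N : ℕ) (ys : List (List Bool)) (j : ℕ) (hj : j < ys.length) :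
    (zeros N :: (List.intersperse (zeros P.γ₂) (ys.map P.guard) ++ [zeros N])).getD (2 * j + 1) [] =
      P.guard (ys[j]) := by
  have hlen : (List.intersperse (zeros P.γ₂) (ys.map P.guard)).length = 2 * ys.length - 1 := by
    simp [List.length_intersperse]
  rw [List.getD_eq_getElem?_getD, List.getElem?_cons_succ,
    List.getElem?_append_left (by rw [hlen]; omega),
    List.getElem?_eq_getElem (by rw [hlen]; omega), Option.getD_some, List.getElem_intersperse]
  simp

/-- Block `2j+2` is a separator `0^{γ₂}` (`j + 1 < m`). [folklore] -/
theorem blocksY_getD_even (N : ℕ) (ys : List (List Bool)) (j : ℕ) (hj : j + 1 < ys.length) :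
    (zeros N :: (List.intersperse (zeros P.γ₂) (ys.map P.guard) ++ [zeros N])).getD (2 * j + 2) [] =
      zeros P.γ₂ := by
  have hlen : (List.intersperse (zeros P.γ₂) (ys.map P.guard)).length = 2 * ys.length - 1 := by
    simp [List.length_intersperse]
  rw [List.getD_eq_getElem?_getD, show 2 * j + 2 = (2 * j + 1) + 1 by ring,
    List.getElem?_cons_succ, List.getElem?_append_left (by rw [hlen]; omega),
    List.getElem?_eq_getElem (by rw [hlen]; omega), Option.getD_some, List.getElem_intersperse]
  simp

/-- Block `2m` is `Rʸ = 0^N`. [folklore] -/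
theorem blocksY_getD_last (N : ℕ) (ys : List (List Bool)) (hys : 1 ≤ ys.length) :
    (zeros N :: (List.intersperse (zeros P.γ₂) (ys.map P.guard) ++ [zeros N])).getD
      (2 * ys.length) [] = zeros N := by
  have hlen : (List.intersperse (zeros P.γ₂) (ys.map P.guard)).length = 2 * ys.length - 1 := by
    simp [List.length_intersperse]
  rw [List.getD_eq_getElem?_getD, show 2 * ys.length = (2 * ys.length - 1) + 1 by omega,
    List.getElem?_cons_succ, List.getElem?_append_right (by rw [hlen]), hlen, Nat.sub_self]
  simp

end Params

/-! ### The lower bound -/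

/-- **Lemma 5.4, part (ii)** (Bringmann–Künnemann, FOCS 2015, lower bound of Def. 3.1 for the
gadget of Lemma 5.3 with `c_subst = 1`): for `1 ≤ m ≤ n`, inputs `xᵢ` of type `(ℓₓ, sₓ)` and `yⱼ` of
length `ℓ_y ≥ ℓₓ`, some alignment `A ∈ 𝒜_{n,m}` has `C + δ(A) ≤ editDist x y`.
[cite: BringmannKunnemannFOCS2015, Lemma 5.4] -/
theorem exists_alignment_le (n m : ℕ) (P : Params) (x : Fin n → List Bool) (y : Fin m → List Bool)
    (hm : 1 ≤ m) (hmn : m ≤ n) (hℓ : P.ℓx ≤ P.ℓy)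
    (hxlen : ∀ i, (x i).length = P.ℓx) (hxcnt : ∀ i, (x i).count true = P.sx)
    (hylen : ∀ j, (y j).length = P.ℓy) :
    ∃ A : List (Fin n × Fin m), IsAlignment A ∧
      P.C n m + alignCost x y A ≤ editDist (P.gadgetX (List.ofFn x)) (P.gadgetY n (List.ofFn y)) := by
  obtain ⟨X, hX⟩ : ∃ X, X = P.gadgetX (List.ofFn x) := ⟨_, rfl⟩
  have hn : 1 ≤ n := hm.trans hmn
  have hxl : ∀ z ∈ List.ofFn x, z.length = P.ℓx := List.forall_mem_ofFn_iff.2 hxlen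
  have hxc : ∀ z ∈ List.ofFn x, z.count true = P.sx := List.forall_mem_ofFn_iff.2 hxcnt
  have hXlen : X.length = n * (8 * P.γ₁ + P.ℓx) + (n - 1) * P.γ₂ := by
    rw [hX, P.length_gadgetX _ hxl, List.length_ofFn]
  have hyl : (List.ofFn y).length = m := List.length_ofFn
  obtain ⟨N, hN⟩ : ∃ N, N = n * P.γ₃ := ⟨_, rfl⟩
  have hY : zeros N ++ P.gadgetX (List.ofFn y) ++ zeros N = P.gadgetY n (List.ofFn y) := by
    rw [hN]; rfl
  -- split an optimal traversal along the `2m+1` blocks of `y` (Fact 5.7)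
  obtain ⟨Bs, hBs⟩ : ∃ Bs, Bs = zeros N ::
      (List.intersperse (zeros P.γ₂) ((List.ofFn y).map P.guard) ++ [zeros N]) := ⟨_, rfl⟩
  obtain ⟨t, ht0, htend, hmono, htle, hsum⟩ :=
    exists_boundaries_editDist_le Bs (by rw [hBs]; exact List.cons_ne_nil _ _) X
  have hBslen : Bs.length = 2 * m + 1 := by
    rw [hBs, P.length_blocksY N _ (by rw [hyl]; exact hm), hyl]
  have hflat : Bs.flatten = P.gadgetY n (List.ofFn y) := by rw [hBs, P.flatten_blocksY, hY]
  rw [hBslen] at htend hsum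
  rw [hflat] at hsum
  have hT : t (2 * m + 1) = X.length := htend _ le_rfl
  -- positions of the inputs `xᵢ` inside `x`, and the alignment rule
  obtain ⟨pos, hpos⟩ : ∃ pos : ℕ → ℕ, ∀ i, pos i = i * (P.γ₄ + P.γ₂) + 4 * P.γ₁ := ⟨_, fun _ => rfl⟩
  have hposlt : ∀ i i', pos i < pos i' → i < i' := by
    intro i i' h
    rw [hpos, hpos] at h
    exact Nat.lt_of_mul_lt_mul_right (a := P.γ₄ + P.γ₂) (by omega)
  obtain ⟨sel, hsel⟩ : ∃ sel : Fin m → Option (Fin n), ∀ j, sel j = (List.finRange n).find?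
      (fun i : Fin n => decide (t (2 * j + 1) ≤ pos i ∧ pos i + P.ℓx + 1 ≤ t (2 * j + 2))) :=
    ⟨_, fun _ => rfl⟩
  refine ⟨(List.finRange m).filterMap fun j => (sel j).map fun i => (i, j), ?_, ?_⟩
  · -- it is an alignment
    simp only [hsel]
    exact isAlignment_filterMap_find pos hposlt P.ℓx (fun j => t (2 * j + 1)) (fun j => t (2 * j + 2))
      fun j j' hjj' => hmono (by omega)
  · -- its cost, block by block
    obtain ⟨V, hV⟩ : ∃ V : ℕ → ℕ, ∀ j, V j = if h : j < m then
        (sel ⟨j, h⟩).elim (maxDist x y) (fun i => editDist (x i) (y ⟨j, h⟩)) else 0 := ⟨_, fun _ => rfl⟩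
    have hcost : alignCost x y ((List.finRange m).filterMap fun j => (sel j).map fun i => (i, j)) =
        ∑ j ∈ range m, V j := by
      unfold alignCost
      have h := sum_map_filterMap_add_mul (List.finRange m) sel (fun i j => editDist (x i) (y j))
        (maxDist x y)
      rw [List.length_finRange] at h
      rw [h, ← Fin.sum_univ_def, ← Fin.sum_univ_eq_sum_range]
      refine Finset.sum_congr rfl fun j _ => ?_
      rw [hV, dif_pos j.isLt]
    rw [hcost]
    -- the terms `F k = 5·editDist(piece k, block k) + 4·|piece k|`
    obtain ⟨F, hF⟩ : ∃ F : ℕ → ℕ, ∀ k, F k =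
        5 * editDist ((X.take (t (k + 1))).drop (t k)) (Bs.getD k []) + 4 * (t (k + 1) - t k) :=
      ⟨_, fun _ => rfl⟩
    -- their sum is `5·(∑ editDist) + 4|x| ≤ 5·editDist x y + 4|x|`
    have hFsum : ∑ k ∈ range (2 * m + 1), F k ≤
        5 * editDist X (P.gadgetY n (List.ofFn y)) + 4 * X.length := by
      rw [Finset.sum_congr rfl fun k _ => hF k, sum_add_distrib, ← mul_sum, ← mul_sum,
        sum_range_tsub hmono, hT, ht0, Nat.sub_zero]
      omega
    -- the first and the last piece: Lemma 5.8
    have hF0 : 5 * N ≤ F 0 := by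
      rw [hF, hBs, List.getD_cons_zero, ht0, List.drop_zero, Nat.sub_zero]
      have h := P.five_mul_le_editDist_take_gadgetX (List.ofFn x) hxl hxc (t 1) N
      rw [← hX, List.length_take, min_eq_left (htle 1)] at h
      exact h
    have hFlast : 5 * N ≤ F (2 * m) := by
      have hl := P.blocksY_getD_last N (List.ofFn y) (by rw [hyl]; exact hm)
      rw [hyl] at hl
      rw [hF, hBs, hl, hT, List.take_length]
      have h := P.five_mul_le_editDist_drop_gadgetX (List.ofFn x) hxl hxc (t (2 * m)) N
      rw [← hX, List.length_drop] at h
      exact h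
    -- the pieces facing `G(yⱼ)`: Claim 5.9
    have hFodd : ∀ j, j < m → 4 * P.γ₄ + 5 * V j ≤ F (2 * j + 1) := by
      intro j hj
      rw [hF, hBs, P.blocksY_getD_odd N _ j (by rw [hyl]; exact hj), List.getElem_ofFn, hV,
        dif_pos hj, hsel]
      have h := P.piece_bound x y hn hℓ hxlen hxcnt hylen (a := t (2 * j + 1)) (b := t (2 * j + 2))
        (hmono (by omega)) (hX ▸ htle _) ⟨j, hj⟩
      simp only [← hX, hpos] at h ⊢
      exact h
    -- the pieces facing separators
    have hFeven : ∀ j, j + 1 < m → 4 * P.γ₂ ≤ F (2 * j + 1 + 1) := by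
      intro j hj
      rw [hF, hBs, show 2 * j + 1 + 1 = 2 * j + 2 by ring,
        P.blocksY_getD_even N _ j (by rw [hyl]; exact hj)]
      have h := length_le_editDist_add_length_left ((X.take (t (2 * j + 2 + 1))).drop (t (2 * j + 2)))
        (zeros P.γ₂)
      rw [length_zeros, length_drop_take', min_eq_left (htle _)] at h
      have h' : t (2 * j + 2) ≤ t (2 * j + 2 + 1) := hmono (by omega)
      omega
    -- summing up
    have hpair : ∑ j ∈ range m, ((4 * P.γ₄ + 5 * V j) + (if j + 1 < m then 4 * P.γ₂ else 5 * N)) ≤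
        ∑ j ∈ range m, (F (2 * j + 1) + F (2 * j + 1 + 1)) := by
      refine sum_le_sum fun j hj => ?_
      rw [mem_range] at hj
      refine Nat.add_le_add (hFodd j hj) ?_
      split_ifs with h
      · exact hFeven j h
      · rw [show 2 * j + 1 + 1 = 2 * m by omega]; exact hFlast
    have hW : ∑ j ∈ range m, (if j + 1 < m then 4 * P.γ₂ else 5 * N) = (m - 1) * (4 * P.γ₂) + 5 * N := by
      obtain ⟨k, rfl⟩ : ∃ k, m = k + 1 := ⟨m - 1, by omega⟩
      rw [sum_range_succ, if_neg (by omega), Nat.add_sub_cancel,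
        Finset.sum_congr rfl (g := fun _ => 4 * P.γ₂) fun j hj => if_pos (by rw [mem_range] at hj; omega),
        sum_const, card_range, smul_eq_mul]
    have htotal : ∑ k ∈ range (2 * m + 1), F k = F 0 + ∑ j ∈ range m, (F (2 * j + 1) + F (2 * j + 1 + 1)) := by
      rw [sum_range_succ', sum_range_two_mul]
      ring
    rw [sum_add_distrib, sum_add_distrib, sum_const, card_range, smul_eq_mul, ← mul_sum, hW] at hpair
    rw [Nat.mul_left_comm m 4 P.γ₄, Nat.mul_left_comm (m - 1) 4 P.γ₂] at hpair
    -- the arithmetic: `5C = 10nγ₃ - 4(n-m)(γ₄+γ₂)`, `|x| = nγ₄ + (n-1)γ₂`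
    have hC : P.C n m + 4 * ((n - m) * (4 * P.γ₁ + P.sx)) = 4 * (n * P.γ₂) := by
      simpa only [Nat.mul_assoc] using P.C_add n m
    have hK : P.γ₄ + P.γ₂ = 5 * (4 * P.γ₁ + P.sx) := P.γ₄_add_γ₂
    have hN' : N = 2 * (n * P.γ₂) := by rw [hN, show P.γ₃ = 2 * P.γ₂ from rfl]; ring
    have e1 : (m - 1) * P.γ₂ + P.γ₂ = m * P.γ₂ := by
      conv_rhs => rw [← Nat.sub_add_cancel hm, Nat.add_mul, one_mul]
    have e2 : (n - 1) * P.γ₂ + P.γ₂ = n * P.γ₂ := by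
      conv_rhs => rw [← Nat.sub_add_cancel hn, Nat.add_mul, one_mul]
    have e3 : (n - m) * P.γ₄ + m * P.γ₄ = n * P.γ₄ := by
      rw [← Nat.add_mul, Nat.sub_add_cancel hmn]
    have e4 : (n - m) * P.γ₂ + m * P.γ₂ = n * P.γ₂ := by
      rw [← Nat.add_mul, Nat.sub_add_cancel hmn]
    have e5 : (n - m) * (4 * P.γ₁ + P.sx) * 5 = (n - m) * P.γ₄ + (n - m) * P.γ₂ := by
      rw [← Nat.mul_add, hK]; ring
    have e6 : X.length = n * P.γ₄ + (n - 1) * P.γ₂ := by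
      rw [hXlen, show P.γ₄ = 8 * P.γ₁ + P.ℓx from rfl]
    rw [← hX]
    omega

/-! ### Lemma 5.4 -/

/-- **Lemma 5.4 of Bringmann–Künnemann (FOCS 2015) for the Levenshtein distance on binary
strings**: the named fact `alignmentGadget_editDist` holds — for `1 ≤ m ≤ n`, inputs `xᵢ` of one
type `(ℓₓ, sₓ)` and `yⱼ` of one length `ℓ_y ≥ ℓₓ`, the strings `x = G(x₁) 0^{γ₂} ⋯ G(x_n)`,
`y = 0^{nγ₃} G(y₁) 0^{γ₂} ⋯ G(y_m) 0^{nγ₃}` and the offset `C = 2nγ₃ - β(n-m)(γ₄+γ₂)` satisfy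
(i) `editDist x y ≤ C + δ(A)` for every structured alignment `A` and (ii) `C + δ(A) ≤ editDist x y`
for some alignment `A`. [cite: BringmannKunnemannFOCS2015, Lemma 5.4] -/
theorem alignmentGadget_editDist_holds : alignmentGadget_editDist := by
  intro n m P x y hm hmn hℓ hxlen hxcnt hylen
  exact ⟨fun Δ hΔ => editDist_gadget_le_structuredCost n m P x y hm hxlen hxcnt Δ hΔ,
    exists_alignment_le n m P x y hm hmn hℓ hxlen hxcnt hylen⟩

end BKGadget

end Literature.Computability.FineGrained
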